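import Mathlib.CategoryTheory.Groupoid
import Mathlib.CategoryTheory.Comma.Basic
import Mathlib.CategoryTheory.Functor.FullyFaithful
import Mathlib.CategoryTheory.EssentialImage
import Mathlib.CategoryTheory.ObjectProperty.FullSubcategory
import Mathlib.CategoryTheory.Products.Basic
import HarnessLib

/-!
# [IUTchII] §1, Example 1.7: radial and coric data — radial environments, multiradiality

Mochizuki, *Inter-universal Teichmüller theory II*, §1, Example 1.7 (i)–(v) and Remark 1.7.1, kurims
manuscript (Dec. 2020) pp. 32–35 [claim: Mochizuki2012, status: disputed] (IUTchII §1 Ex 1.7, kurims pp.32-35).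
Record-only typing under the claim key `Mochizuki2012` (D-0012, disputed). This Example is PURE CATEGORY
THEORY ("a type of mathematical data … gives rise to a category each of whose morphisms is an
isomorphism"), so everything here is a REAL definition over Mathlib (`Groupoid`, `Functor.Full`,
`Functor.EssSurj`, `Comma`), and the two printed "one verifies immediately" claims are PROVED:

* `IUTchII:Ex1.7(i)` — a *radial environment* `(ℛ, 𝒞, Φ : ℛ → 𝒞)`: groupoids of radial / coric data and an
  essentially surjective *radial functor* (`RadialEnvironment`); families `{Φ_i : ℛ_i → 𝒞}_{i ∈ I}` of
  copies with the same codomain (Fig. 1.1) are the constant family (`copies`).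
* `IUTchII:Ex1.7(ii)` — *multiradial* := `Φ` full; *uniradial* := not full; the *tautological
  multiradialization* `(ℛ^mtz, 𝒞, Φ^mtz)` (objects `(R, C, α)` with `α` the full poly-isomorphism
  `Φ(R) ≅ C`, morphisms pairs of isomorphisms), its radial functor `(R, C, α) ↦ C`, the natural functor
  `ℛ → ℛ^mtz`, and the printed claim that `Φ^mtz` is full and essentially surjective (PROVED:
  `Multiradialization.full`, `.essSurj`).
* `IUTchII:Ex1.7(iii)` — `ℛ ×_𝒞 ℛ` (= Mathlib's `Comma Φ Φ`), the switching functor `sw`, and the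
  printed claims "multiradiality is equivalent to the condition that every object `(R₁, R₂, α)` of
  `ℛ ×_𝒞 ℛ` be isomorphic to `(R₁, R₁, id)`" (PROVED: `multiradial_iff_iso_diagonal`) and "the switching
  functor preserves the isomorphism class of objects" (PROVED: `sw_obj_iso`).
* `IUTchII:Ex1.7(iv)` — daggered data, 1-commutative squares `Ψ_ℛ, Ψ_𝒞`, *multiradially / uniradially /
  corically defined* functors (definitions).
* `IUTchII:Ex1.7(v)` and `IUTchII:Rmk1.7.1` — "the multiradiality of `Ψ_ℛ` implies that one may lift
  gluing isomorphisms in `𝒞` to gluing isomorphisms in `ℛ`", unique "up to an indeterminacy arising from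
  the extent that `Φ` fails to be faithful" (PROVED: `exists_lift_iso`, `lift_unique_of_faithful`); the
  "fibration with connection / parallel transport" reading is expository.

"Type of mathematical data", "functorial algorithm" are formalised as categories and functors exactly as
the text instructs ("gives rise to a category … gives rise to a functor"); cf. [IUTchIV] §3 (species) =
universe-polymorphic declarations (cell FOUNDATIONS row 24). Nothing here is specific to the disputed
step.
-/

namespace Literature.IUT.HodgeArakelov

open CategoryTheory

universe v u

/-! ## Example 1.7 (i): radial environments -/

-- justification: objects and morphisms of `ℛ`, `𝒞` live in independent universes `u`, `v` exactly as
-- for Mathlib's bundled `Cat.{v, u}`; the bundling structure necessarily has type `max (u+1) (v+1)`.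
set_option linter.checkUnivs false in
/-- **IUTchII:Ex1.7(i)** (kurims p. 32) and **IUTchII:Ex1.7(ii)** (first sentence): "this type of
mathematical data gives rise to a category `ℛ` — i.e., each of whose objects is a specific collection of
radial data, and each of whose morphisms is an isomorphism … `𝒞` for the category obtained by considering
specific collections of coric data and isomorphisms of collections of coric data … a functorial algorithm
— which we shall refer to as radial — … gives rise to a functor `Φ : ℛ → 𝒞`. In the following discussion,
we shall assume that this functor is essentially surjective. … We shall refer to a triple
`(ℛ, 𝒞, Φ : ℛ → 𝒞)` … as a radial environment." [claim: Mochizuki2012, status: disputed] (IUTchII §1 Ex 1.7 (i)(ii), kurims p.32) -/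
structure RadialEnvironment : Type (max (u + 1) (v + 1)) where
  /-- the category `ℛ` of radial data (a groupoid) -/
  R : Type u
  [grpdR : Groupoid.{v} R]
  /-- the category `𝒞` of coric data (a groupoid) -/
  C : Type u
  [grpdC : Groupoid.{v} C]
  /-- the radial functor `Φ : ℛ → 𝒞` -/
  Φ : R ⥤ C
  /-- "we shall assume that this functor is essentially surjective" -/
  essSurj : Φ.EssSurj

namespace RadialEnvironment

attribute [instance] grpdR grpdC essSurj

variable (E : RadialEnvironment.{v, u})

/-- In the groupoid `ℛ` every morphism is an isomorphism. [claim: Mochizuki2012, status: disputed] (IUTchII §1 Ex 1.7 (i), kurims p.32) -/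
def isoOf {X Y : E.R} (f : X ⟶ Y) : X ≅ Y := ⟨f, Groupoid.inv f, Groupoid.comp_inv f, Groupoid.inv_comp f⟩

/-- Unfolding lemma for `isoOf` (plumbing). [folklore] -/
@[simp] private lemma isoOf_hom {X Y : E.R} (f : X ⟶ Y) : (E.isoOf f).hom = f := rfl

/-- Unfolding lemma for `isoOf` (plumbing). [folklore] -/
@[simp] private lemma isoOf_inv {X Y : E.R} (f : X ⟶ Y) : (E.isoOf f).inv = Groupoid.inv f := rfl

/-- **IUTchII:Ex1.7(i)** (kurims p. 32), Fig. 1.1: "collections `{Φ_i : ℛ_i → 𝒞}_{i ∈ I}` of copies of `Φ`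
and `ℛ`, such that the various copies of `Φ` have the same codomain `𝒞` … one may think of each `ℛ_i` as
the category of radial data equipped with a label `i ∈ I`". [claim: Mochizuki2012, status: disputed] (IUTchII §1 Ex 1.7 (i), kurims p.32) -/
def copies (I : Type*) : I → (E.R ⥤ E.C) := fun _ => E.Φ

/-! ## Example 1.7 (ii): multiradial / uniradial; the tautological multiradialization -/

/-- **IUTchII:Ex1.7(ii)** (kurims pp. 32–33): "If `Φ` is full, then we shall refer to the radial
environment under consideration as multiradial." [claim: Mochizuki2012, status: disputed] (IUTchII §1 Ex 1.7 (ii), kurims p.33) -/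
def IsMultiradial : Prop := E.Φ.Full

/-- **IUTchII:Ex1.7(ii)** (kurims p. 33): "We shall refer to a radial environment which is not multiradial
as uniradial." [claim: Mochizuki2012, status: disputed] (IUTchII §1 Ex 1.7 (ii), kurims p.33) -/
def IsUniradial : Prop := ¬ E.IsMultiradial

/-- **IUTchII:Ex1.7(ii)** (kurims p. 33), objects of the tautological multiradialization `ℛ^mtz`: "A
collection of radial data `(R, C, α)` of this multiradialization consists of an object `R` of `ℛ`, an object
`C` of `𝒞`, and the full poly-isomorphism [cf. [IUTchI], §0] `α : Φ(R) ≅ C`" — the full poly-isomorphism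
being the set of ALL isomorphisms `Φ(R) ≅ C`, the datum carried is that this set is nonempty; "An
isomorphism … `(R, C, α) ≅ (R*, C*, α*)` … consists of a pair of isomorphisms `R ≅ R*`, `C ≅ C*` [which are
necessarily compatible with `α, α*`]" — so `ℛ^mtz` is the full subcategory of `ℛ × 𝒞` on such pairs.
[claim: Mochizuki2012, status: disputed] (IUTchII §1 Ex 1.7 (ii), kurims p.33) -/
def mtzProperty : ObjectProperty (E.R × E.C) := fun p => Nonempty (E.Φ.obj p.1 ≅ p.2)

/-- **IUTchII:Ex1.7(ii)**: the category `ℛ^mtz` of radial data of the tautological multiradialization.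
[claim: Mochizuki2012, status: disputed] (IUTchII §1 Ex 1.7 (ii), kurims p.33) -/
abbrev Mtz : Type u := E.mtzProperty.FullSubcategory

/-- `ℛ^mtz` is a groupoid (full subcategory of the groupoid `ℛ × 𝒞`). [claim: Mochizuki2012, status: disputed] (IUTchII §1 Ex 1.7 (ii), kurims p.33) -/
instance : Groupoid.{v} E.Mtz :=
  inferInstanceAs (Groupoid (InducedCategory (E.R × E.C) ObjectProperty.FullSubcategory.obj))

/-- **IUTchII:Ex1.7(ii)**: "The radial algorithm of the multiradialization is taken to be the assignment
`(R, C, α) ↦ C`" — the functor `Φ^mtz : ℛ^mtz → 𝒞`. [claim: Mochizuki2012, status: disputed] (IUTchII §1 Ex 1.7 (ii), kurims p.33) -/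
def Φmtz : E.Mtz ⥤ E.C := E.mtzProperty.ι ⋙ CategoryTheory.Prod.snd E.R E.C

/-- **IUTchII:Ex1.7(ii)**: "a natural functor `ℛ → ℛ^mtz` [i.e., given by the assignment
`R ↦ (R, Φ(R), Φ(R) ≅ Φ(R))`]". [claim: Mochizuki2012, status: disputed] (IUTchII §1 Ex 1.7 (ii), kurims p.33) -/
def toMtz : E.R ⥤ E.Mtz :=
  ObjectProperty.lift E.mtzProperty (Functor.id E.R |>.prod' E.Φ) fun _ => ⟨Iso.refl _⟩

/-- **IUTchII:Ex1.7(ii)** (kurims p. 33), PROVED: "whose associated radial functor is clearly full [cf. our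
assumption that any two collections of radial data are isomorphic!]" — under that assumption `Φ^mtz` is
full (in groupoids every compatible square exists trivially since `α` is the FULL poly-isomorphism).
[claim: Mochizuki2012, status: disputed] (IUTchII §1 Ex 1.7 (ii), kurims p.33) -/
theorem Φmtz_full (h : ∀ R R' : E.R, Nonempty (R ≅ R')) : E.Φmtz.Full where
  map_surjective {X Y} := by
    intro g
    obtain ⟨e⟩ := h X.obj.1 Y.obj.1
    exact ⟨InducedCategory.homMk (e.hom, g), rfl⟩

/-- **IUTchII:Ex1.7(ii)** (kurims p. 33), PROVED: `Φ^mtz` is "essentially surjective, hence determines a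
[tautologically!] multiradial environment". [claim: Mochizuki2012, status: disputed] (IUTchII §1 Ex 1.7 (ii), kurims p.33) -/
theorem Φmtz_essSurj : E.Φmtz.EssSurj where
  mem_essImage C := by
    obtain ⟨R, ⟨e⟩⟩ := Functor.EssSurj.mem_essImage (F := E.Φ) C
    exact ⟨⟨(R, C), ⟨e⟩⟩, ⟨Iso.refl C⟩⟩

/-- **IUTchII:Ex1.7(ii)**: the tautological multiradialization `(ℛ^mtz, 𝒞, Φ^mtz : ℛ^mtz → 𝒞)` as a
radial environment ("The coric data of the multiradialization is taken to be the coric data of the original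
radial environment"). [claim: Mochizuki2012, status: disputed] (IUTchII §1 Ex 1.7 (ii), kurims p.33) -/
def multiradialization : RadialEnvironment.{v, u} where
  R := E.Mtz
  C := E.C
  Φ := E.Φmtz
  essSurj := E.Φmtz_essSurj

/-- **IUTchII:Ex1.7(ii)**, PROVED: under the printed assumption ("any two collections of radial data are
isomorphic") the tautological multiradialization is multiradial. [claim: Mochizuki2012, status: disputed] (IUTchII §1 Ex 1.7 (ii), kurims p.33) -/
theorem multiradialization_isMultiradial (h : ∀ R R' : E.R, Nonempty (R ≅ R')) :
    E.multiradialization.IsMultiradial := E.Φmtz_full h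

/-! ## Example 1.7 (iii): `ℛ ×_𝒞 ℛ` and the switching functor -/

/-- **IUTchII:Ex1.7(iii)** (kurims p. 34): "`ℛ ×_𝒞 ℛ` for the category whose objects are triples
`(R₁, R₂, α)` consisting of a pair of objects `R₁, R₂` of `ℛ` and an isomorphism `α : Φ(R₁) ≅ Φ(R₂)` …, and
whose morphisms are the morphisms [in the evident sense] between such triples [cf. the categorical fiber
product of [FrdI], §0]" — Mathlib's comma category `Comma Φ Φ` (in the groupoid `𝒞` every `α` is an
isomorphism). [claim: Mochizuki2012, status: disputed] (IUTchII §1 Ex 1.7 (iii), kurims p.34) -/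
abbrev FiberSquare : Type (max u v) := Comma E.Φ E.Φ

/-- **IUTchII:Ex1.7(iii)**: the diagonal object `(R₁, R₁, id : Φ(R₁) ≅ Φ(R₁))` of `ℛ ×_𝒞 ℛ`.
[claim: Mochizuki2012, status: disputed] (IUTchII §1 Ex 1.7 (iii), kurims p.34) -/
def diagonal (R : E.R) : E.FiberSquare := ⟨R, R, 𝟙 _⟩

/-- **IUTchII:Ex1.7(iii)** (kurims p. 34): "`sw : ℛ ×_𝒞 ℛ → ℛ ×_𝒞 ℛ` for the functor
`(R₁, R₂, α) ↦ (R₂, R₁, α⁻¹)` obtained by switching the two factors of `ℛ`."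
[claim: Mochizuki2012, status: disputed] (IUTchII §1 Ex 1.7 (iii), kurims p.34) -/
def sw : E.FiberSquare ⥤ E.FiberSquare where
  obj X := ⟨X.right, X.left, Groupoid.inv X.hom⟩
  map {X Y} f :=
    { left := f.right
      right := f.left
      w := by
        have hw := f.w
        rw [Groupoid.inv_eq_inv, Groupoid.inv_eq_inv, IsIso.comp_inv_eq, Category.assoc,
          IsIso.eq_inv_comp]
        exact hw.symm }

/-- **IUTchII:Ex1.7(iii)** (kurims p. 34), PROVED: "one verifies immediately that this multiradiality is,
in fact, equivalent to the condition that every object `(R₁, R₂, α)` of `ℛ ×_𝒞 ℛ` be isomorphic to the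
object `(R₁, R₁, id : Φ(R₁) ≅ Φ(R₁))`". [claim: Mochizuki2012, status: disputed] (IUTchII §1 Ex 1.7 (iii), kurims p.34) -/
theorem multiradial_iff_iso_diagonal :
    E.IsMultiradial ↔ ∀ X : E.FiberSquare, Nonempty (X ≅ E.diagonal X.left) := by
  constructor
  · intro hfull X
    haveI : E.Φ.Full := hfull
    obtain ⟨f, hf⟩ := E.Φ.map_surjective X.hom
    refine ⟨Comma.isoMk (Iso.refl _) (E.isoOf f).symm ?_⟩
    change E.Φ.map (𝟙 _) ≫ 𝟙 _ = X.hom ≫ E.Φ.map (Groupoid.inv f)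
    rw [← hf, ← Functor.map_comp, Groupoid.comp_inv]
    simp
  · intro h
    refine ⟨fun {R₁ R₂} g => ?_⟩
    obtain ⟨e⟩ := h ⟨R₁, R₂, g⟩
    let a : R₁ ⟶ R₁ := e.hom.left
    let b : R₂ ⟶ R₁ := e.hom.right
    have hw : E.Φ.map a ≫ 𝟙 _ = g ≫ E.Φ.map b := e.hom.w
    rw [Category.comp_id] at hw
    refine ⟨a ≫ Groupoid.inv b, ?_⟩
    rw [Functor.map_comp, hw, Category.assoc, ← Functor.map_comp, Groupoid.comp_inv, Functor.map_id,
      Category.comp_id]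

/-- **IUTchII:Ex1.7(iii)** (kurims p. 34), PROVED: "one formal consequence of the multiradiality of a radial
environment … is the property that the switching functor `sw` preserves the isomorphism class of objects
of `ℛ ×_𝒞 ℛ`." [claim: Mochizuki2012, status: disputed] (IUTchII §1 Ex 1.7 (iii), kurims p.34) -/
theorem sw_obj_iso (h : E.IsMultiradial) (X : E.FiberSquare) : Nonempty (E.sw.obj X ≅ X) := by
  have h' := (E.multiradial_iff_iso_diagonal).mp h
  obtain ⟨e₁⟩ := h' X
  obtain ⟨e₂⟩ := h' (E.sw.obj X)
  haveI : E.Φ.Full := h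
  obtain ⟨f, -⟩ := E.Φ.map_surjective X.hom
  -- `sw X ≅ diag(X.right)`, `diag(X.right) ≅ diag(X.left)` via `f⁻¹`, `diag(X.left) ≅ X`
  have e₃ : E.diagonal X.right ≅ E.diagonal X.left :=
    Comma.isoMk (E.isoOf f).symm (E.isoOf f).symm (by simp [diagonal])
  exact ⟨e₂ ≪≫ e₃ ≪≫ e₁.symm⟩

/-! ## Example 1.7 (iv): daggered data; multiradially / corically defined functors -/

/-- **IUTchII:Ex1.7(iv)** (kurims p. 34): "suppose that we are given another radial environment
`(ℛ†, 𝒞†, Φ†)` [daggered radial/coric data] … [and] a 1-commutative diagram `Ψ_ℛ : ℛ → ℛ†`,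
`Ψ_𝒞 : 𝒞 → 𝒞†`, `Φ† ∘ Ψ_ℛ ≅ Ψ_𝒞 ∘ Φ` — where `Ψ_ℛ` and `Ψ_𝒞` arise from functorial algorithms."
[claim: Mochizuki2012, status: disputed] (IUTchII §1 Ex 1.7 (iv), kurims p.34) -/
structure RadialMorphism (E F : RadialEnvironment.{v, u}) : Type (max u v) where
  /-- `Ψ_ℛ` -/
  ΨR : E.R ⥤ F.R
  /-- `Ψ_𝒞` -/
  ΨC : E.C ⥤ F.C
  /-- 1-commutativity of the square -/
  comm : ΨR ⋙ F.Φ ≅ E.Φ ⋙ ΨC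

/-- **IUTchII:Ex1.7(iv)** (kurims p. 34): "If `(ℛ, 𝒞, Φ)` is multiradial (respectively, uniradial), then we
shall refer to `Ψ_ℛ` as multiradially defined (respectively, uniradially defined)".
[claim: Mochizuki2012, status: disputed] (IUTchII §1 Ex 1.7 (iv), kurims p.34) -/
def RadialMorphism.IsMultiradiallyDefined {E F : RadialEnvironment.{v, u}} (_Ψ : RadialMorphism E F) :
    Prop := E.IsMultiradial

/-- **IUTchII:Ex1.7(iv)**: "uniradially defined". [claim: Mochizuki2012, status: disputed] (IUTchII §1 Ex 1.7 (iv), kurims p.34) -/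
def RadialMorphism.IsUniradiallyDefined {E F : RadialEnvironment.{v, u}} (_Ψ : RadialMorphism E F) :
    Prop := E.IsUniradial

/-- **IUTchII:Ex1.7(iv)** (kurims p. 34): "If `Ψ_ℛ` admits a 1-factorization `Ξ_ℛ ∘ Φ` for some
`Ξ_ℛ : 𝒞 → ℛ†` that arises from a functorial algorithm, then we shall say that `Ψ_ℛ` is corically defined,
or coric." [claim: Mochizuki2012, status: disputed] (IUTchII §1 Ex 1.7 (iv), kurims p.34) -/
def RadialMorphism.IsCoricallyDefined {E F : RadialEnvironment.{v, u}} (Ψ : RadialMorphism E F) : Prop :=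
  ∃ Ξ : E.C ⥤ F.R, Nonempty (Ψ.ΨR ≅ E.Φ ⋙ Ξ)

/-- **IUTchII:Ex1.7(iv)** (kurims p. 34), PROVED: "by considering the case where `ℛ = 𝒞`, `Φ = id_ℛ`, one
may think of the notion of a corically defined `Ψ_ℛ` as a sort of special case of the notion of a
multiradial `Ψ_ℛ`" — the identity radial environment is multiradial.
[claim: Mochizuki2012, status: disputed] (IUTchII §1 Ex 1.7 (iv), kurims p.34) -/
theorem isMultiradial_of_id (C : Type u) [Groupoid.{v} C] :
    (⟨C, C, Functor.id C, inferInstance⟩ : RadialEnvironment.{v, u}).IsMultiradial :=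
  (inferInstance : (Functor.id C).Full)

/-! ## Example 1.7 (v) and Remark 1.7.1: lifting gluing isomorphisms -/

/-- **IUTchII:Ex1.7(v)** (kurims p. 35), PROVED: "the multiradiality of `Ψ_ℛ` implies that one may lift
these gluing isomorphisms in `𝒞` to gluing isomorphisms in `ℛ`" — fullness of `Φ` gives, for radial data
`R₁, R₂` and an isomorphism `β : Φ(R₁) ≅ Φ(R₂)`, an isomorphism `R₁ ≅ R₂` mapping to `β`. (The
"simultaneous execution relative to various collections of radial input data indexed by `I`" reading is
expository.) [claim: Mochizuki2012, status: disputed] (IUTchII §1 Ex 1.7 (v), kurims p.35) -/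
theorem exists_lift_iso (h : E.IsMultiradial) {R₁ R₂ : E.R} (β : E.Φ.obj R₁ ≅ E.Φ.obj R₂) :
    ∃ f : R₁ ≅ R₂, E.Φ.mapIso f = β := by
  haveI : E.Φ.Full := h
  obtain ⟨g, hg⟩ := E.Φ.map_surjective β.hom
  exact ⟨E.isoOf g, Iso.ext (by simpa using hg)⟩

/-- **IUTchII:Rmk1.7.1** (kurims p. 35), PROVED: "up to an indeterminacy arising from the extent that `Φ`
fails to be faithful, such liftings are unique" — if `Φ` is faithful, lifts of a gluing isomorphism are
unique. (The "fibration equipped with a connection / parallel transport between fibers" analogy is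
expository.) [claim: Mochizuki2012, status: disputed] (IUTchII §1 Rmk 1.7.1, kurims p.35) -/
theorem lift_unique_of_faithful [E.Φ.Faithful] {R₁ R₂ : E.R} (f g : R₁ ≅ R₂)
    (h : E.Φ.mapIso f = E.Φ.mapIso g) : f = g :=
  Iso.ext (E.Φ.map_injective (by simpa using congrArg Iso.hom h))

end RadialEnvironment

end Literature.IUT.HodgeArakelov
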